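import Summits.ResolutionOfSingularities.ResolutionOfSingularities.Theorems.LossEntryW03
import HarnessLib

/-!
# LossEntryW04 — walk plumbing of the loss→entry law `LawLossEntry`, part 4/11

decomp-res-lens-3, gen 29 (HOME/decomp-res-lens-3/g29/NODE-g29.md).  TOOL at 0 toward the residual item
stmt-ResolutionOfSingularities-27367 (`WallCut.NoLossyStrictTailsDeep` ⟸ `LossEpisode.LawLossEntry`).  Imports part 3 (`Theorems.LossEntryW03`, to be landed first).

Contents: §7 swap and outer-shear invariance of entry vertices (`swapShear_swapShear`, `swapShear_shear_shear`, `toLex_entryPt_le`, `vertexOf_entryPts_eq_of_dom`, `exists_dom(_of_mem_support)_shear(_of_mem_support)`).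
-/

open MvPolynomial Finset
open Literature.AlgebraicGeometry.Resolution
open Literature.AlgebraicGeometry.Resolution.Hauser2010
open Literature.AlgebraicGeometry.Resolution.PointBlowup
open Summit.ResolutionOfSingularities.ResolutionOfSingularities.Theorems.TightDefectClasses
open Summit.ResolutionOfSingularities.ResolutionOfSingularities.Theorems.TightDefectStrongWalks
open Summit.ResolutionOfSingularities.ResolutionOfSingularities.Theorems.ItineraryCutClasses
open Summit.ResolutionOfSingularities.ResolutionOfSingularities.Theorems.BoundaryLedger
open Summit.ResolutionOfSingularities.ResolutionOfSingularities.Theorems.ProximityCut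
open Summit.ResolutionOfSingularities.ResolutionOfSingularities.Theorems.LossIsFatalLayer (chartMap chartMap_X chartMap_X_self
  chartMap_X_ne chartMap_C)
open Summit.ResolutionOfSingularities.ResolutionOfSingularities.Theorems.LossExitCone
open Summit.ResolutionOfSingularities.ResolutionOfSingularities.Theorems.LossPolygon

/-! ## §7 Swap and outer-shear invariance of entry vertices (the (c)-presentation of a loss) -/

namespace Summit.ResolutionOfSingularities.ResolutionOfSingularities.Theorems.LossPolygon

variable {K : Type} [Field K] [DecidableEq K]
variable {q : ℕ}

section Swap

variable {i j l : Fin 3}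

omit [DecidableEq K] in
/-- **`swapShear` IS AN INVOLUTION UP TO RELABELLING (PROVED):** `swapShear l j g ν ∘ swapShear j l ν g = id` for `ν g = 1`.
[new; elementary] -/
theorem swapShear_swapShear (hij : i ≠ j) (hil : i ≠ l) (hjl : j ≠ l) {ν g : K} (hνg : ν * g = 1)
    (G : MvPolynomial (Fin 3) K) : swapShear l j g ν (swapShear j l ν g G) = G := by
  have h2 : (C ν : MvPolynomial (Fin 3) K) * C g = 1 := by rw [← map_mul, hνg, map_one]
  have key : (swapShear l j g ν).comp (swapShear j l ν g) = AlgHom.id K (MvPolynomial (Fin 3) K) := by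
    refine MvPolynomial.algHom_ext fun w => ?_
    rw [AlgHom.comp_apply, AlgHom.id_apply]
    rcases fin3_eq_or i j l w hij hil hjl with h | h | h <;> rw [h]
    · rw [swapShear_X j l ν g i, if_neg hij, if_neg hil, swapShear_X l j g ν i, if_neg hil, if_neg hij]
    · rw [swapShear_X j l ν g j, if_pos rfl, map_mul, algHom_C, algebraMap_eq, swapShear_X l j g ν l, if_pos rfl,
        map_neg, map_neg]
      linear_combination (X j) * h2
    · rw [swapShear_X j l ν g l, if_neg (Ne.symm hjl), if_pos rfl, map_add, map_mul, algHom_C, algebraMap_eq,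
        swapShear_X l j g ν l, if_pos rfl, swapShear_X l j g ν j, if_neg hjl, if_pos rfl, map_neg]
      linear_combination (X l) * h2
  rw [← AlgHom.comp_apply, key, AlgHom.id_apply]

omit [DecidableEq K] in
/-- **THE (c)-PRESENTATION IS THE (b)-PRESENTATION SWAPPED AND SHEARED (PROVED):** for `ν λ = 1`,
`swapShear j l ν λ (σ_{i,l,β} σ_{j,l,ν} F) = σ_{i,l,β} (σ_{i,j,βλ} σ_{l,j,λ} F)` — the closed point `(β : ν : 1) = (βλ : 1 : λ)` of
the exceptional plane read in the chart `l` resp. `j`. [new; elementary] -/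
theorem swapShear_shear_shear (hij : i ≠ j) (hil : i ≠ l) (hjl : j ≠ l) {ν lam : K} (hνl : ν * lam = 1) (β : K)
    (F : MvPolynomial (Fin 3) K) :
    swapShear j l ν lam (shear i l β (shear j l ν F)) = shear i l β (shear i j (β * lam) (shear l j lam F)) := by
  have h2 : (C ν : MvPolynomial (Fin 3) K) * C lam = 1 := by rw [← map_mul, hνl, map_one]
  have key : ((swapShear j l ν lam).comp (shear i l β)).comp (shear j l ν) =
      ((shear (K := K) i l β).comp (shear i j (β * lam))).comp (shear l j lam) := by
    refine MvPolynomial.algHom_ext fun w => ?_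
    simp only [AlgHom.comp_apply]
    rcases fin3_eq_or i j l w hij hil hjl with h | h | h <;> rw [h]
    · rw [shear_X j l ν i, if_neg hij, shear_X i l β i, if_pos rfl, map_add, map_mul, algHom_C, algebraMap_eq,
        swapShear_X j l ν lam i, if_neg hij, if_neg hil, swapShear_X j l ν lam l, if_neg (Ne.symm hjl), if_pos rfl,
        shear_X l j lam i, if_neg hil, shear_X i j (β * lam) i, if_pos rfl, map_add, map_mul, algHom_C, algebraMap_eq,
        shear_X i l β i, if_pos rfl, shear_X i l β j, if_neg (Ne.symm hij), map_mul C β lam]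
      ring
    · rw [shear_X j l ν j, if_pos rfl, map_add, map_mul, algHom_C, algebraMap_eq, shear_X i l β j, if_neg (Ne.symm hij),
        shear_X i l β l, if_neg (Ne.symm hil), map_add, map_mul, algHom_C, algebraMap_eq, swapShear_X j l ν lam j, if_pos rfl,
        swapShear_X j l ν lam l, if_neg (Ne.symm hjl), if_pos rfl,
        shear_X l j lam j, if_neg hjl, shear_X i j (β * lam) j, if_neg (Ne.symm hij), shear_X i l β j, if_neg (Ne.symm hij),
        map_neg]
      linear_combination (X j) * h2
    · rw [shear_X j l ν l, if_neg (Ne.symm hjl), shear_X i l β l, if_neg (Ne.symm hil), swapShear_X j l ν lam l,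
        if_neg (Ne.symm hjl), if_pos rfl,
        shear_X l j lam l, if_pos rfl, map_add, map_mul, algHom_C, algebraMap_eq, shear_X i j (β * lam) l, if_neg (Ne.symm hil),
        shear_X i j (β * lam) j, if_neg (Ne.symm hij), map_add, map_mul, algHom_C, algebraMap_eq, shear_X i l β l,
        if_neg (Ne.symm hil), shear_X i l β j, if_neg (Ne.symm hij)]
  have h := congrArg (fun f : MvPolynomial (Fin 3) K →ₐ[K] MvPolynomial (Fin 3) K => f F) key
  simpa only [AlgHom.comp_apply] using h

end Swap

section EntryDom

/-- **ENTRY POINTS COMPARE THROUGH EXPONENTS (PROVED):** equal degree `≥ o`, smaller second-letter and ceiling exponents give a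
lexicographically smaller entry point (possibly in another frame). [new; elementary] -/
theorem toLex_entryPt_le {s o : ℕ} {a c a' c' : Fin 3} {E E' : Fin 3 →₀ ℕ} (hdeg : E'.degree = E.degree)
    (ho : o ≤ E.degree) (hsec : E' a' ≤ E a) (hceil : E' c' ≤ E c) (hc : E c < s) :
    toLex (entryPt s o a' c' E') ≤ toLex (entryPt s o a c E) := by
  have hd : (0 : ℚ) < ((s : ℕ) : ℚ) - ((E c : ℕ) : ℚ) := by
    have : ((E c : ℕ) : ℚ) < ((s : ℕ) : ℚ) := by exact_mod_cast hc
    linarith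
  have hdd : ((s : ℕ) : ℚ) - ((E c : ℕ) : ℚ) ≤ ((s : ℕ) : ℚ) - ((E' c' : ℕ) : ℚ) := by
    have : ((E' c' : ℕ) : ℚ) ≤ ((E c : ℕ) : ℚ) := by exact_mod_cast hceil
    linarith
  have hN : (0 : ℚ) ≤ ((E.degree : ℕ) : ℚ) - o := by
    have : ((o : ℕ) : ℚ) ≤ ((E.degree : ℕ) : ℚ) := by exact_mod_cast ho
    linarith
  have h1 : (((E'.degree : ℕ) : ℚ) - o) / (((s : ℕ) : ℚ) - E' c') ≤ (((E.degree : ℕ) : ℚ) - o) / (((s : ℕ) : ℚ) - E c) := by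
    rw [hdeg]; exact div_le_div_of_nonneg_left hN hd hdd
  rw [Prod.Lex.toLex_le_toLex]
  rcases h1.lt_or_eq with h | h
  · exact Or.inl h
  · refine Or.inr ⟨h, ?_⟩
    show ((E' a' : ℕ) : ℚ) / (((s : ℕ) : ℚ) - E' c') ≤ ((E a : ℕ) : ℚ) / (((s : ℕ) : ℚ) - E c)
    have hsec' : ((E' a' : ℕ) : ℚ) ≤ ((E a : ℕ) : ℚ) := by exact_mod_cast hsec
    calc ((E' a' : ℕ) : ℚ) / (((s : ℕ) : ℚ) - E' c') ≤ ((E a : ℕ) : ℚ) / (((s : ℕ) : ℚ) - E' c') :=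
          div_le_div_of_nonneg_right hsec' (le_trans hd.le hdd)
      _ ≤ ((E a : ℕ) : ℚ) / (((s : ℕ) : ℚ) - E c) := div_le_div_of_nonneg_left (by positivity) hd hdd

/-- **… and a strictly smaller ceiling exponent at degree `> o` gives a lexicographically smaller entry point outright.**
[new; elementary] -/
theorem toLex_entryPt_le_of_lt {s o : ℕ} {a c a' c' : Fin 3} {E E' : Fin 3 →₀ ℕ} (hdeg : E'.degree = E.degree)
    (ho : o < E.degree) (hceil : E' c' < E c) (hc : E c < s) :
    toLex (entryPt s o a' c' E') ≤ toLex (entryPt s o a c E) := by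
  have hd : (0 : ℚ) < ((s : ℕ) : ℚ) - ((E c : ℕ) : ℚ) := by
    have : ((E c : ℕ) : ℚ) < ((s : ℕ) : ℚ) := by exact_mod_cast hc
    linarith
  have hdd : ((s : ℕ) : ℚ) - ((E c : ℕ) : ℚ) < ((s : ℕ) : ℚ) - ((E' c' : ℕ) : ℚ) := by
    have : ((E' c' : ℕ) : ℚ) < ((E c : ℕ) : ℚ) := by exact_mod_cast hceil
    linarith
  have hN : (0 : ℚ) < ((E.degree : ℕ) : ℚ) - o := by
    have : ((o : ℕ) : ℚ) < ((E.degree : ℕ) : ℚ) := by exact_mod_cast ho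
    linarith
  rw [Prod.Lex.toLex_le_toLex]
  left
  show (((E'.degree : ℕ) : ℚ) - o) / (((s : ℕ) : ℚ) - E' c') < (((E.degree : ℕ) : ℚ) - o) / (((s : ℕ) : ℚ) - E c)
  rw [hdeg]; exact div_lt_div_of_pos_left hN hd hdd

omit [DecidableEq K] in
/-- **MUTUALLY DOMINATING ENTRY SETS HAVE THE SAME VERTEX (PROVED)** — the exponent-level dominations of `§6`/`§7` lifted to the
entry point sets (possibly in different frames). [new; elementary] -/
theorem vertexOf_entryPts_eq_of_dom {s o : ℕ} {a c a' c' : Fin 3} {G G' : MvPolynomial (Fin 3) K}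
    (h1 : ∀ E ∈ G.support, E c < s → ∃ E' ∈ G'.support, E' c' < s ∧ toLex (entryPt s o a' c' E') ≤ toLex (entryPt s o a c E))
    (h2 : ∀ E' ∈ G'.support, E' c' < s → ∃ E ∈ G.support, E c < s ∧ toLex (entryPt s o a c E) ≤ toLex (entryPt s o a' c' E'))
    (hne : (entryPts s o a c G).Nonempty) :
    (entryPts s o a' c' G').Nonempty ∧ vertexOf (entryPts s o a c G) = vertexOf (entryPts s o a' c' G') := by
  classical
  have hA : ∀ x ∈ entryPts s o a c G, ∃ y ∈ entryPts s o a' c' G', toLex y ≤ toLex x := by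
    intro x hx
    simp only [entryPts, Finset.mem_image, Finset.mem_filter] at hx
    obtain ⟨E, ⟨hE, hEc⟩, rfl⟩ := hx
    obtain ⟨E', hE', hE'c, hle⟩ := h1 E hE hEc
    exact ⟨_, entryPt_mem_entryPts s o a' c' G' hE' hE'c, hle⟩
  have hB : ∀ y ∈ entryPts s o a' c' G', ∃ x ∈ entryPts s o a c G, toLex x ≤ toLex y := by
    intro y hy
    simp only [entryPts, Finset.mem_image, Finset.mem_filter] at hy
    obtain ⟨E', ⟨hE', hE'c⟩, rfl⟩ := hy
    obtain ⟨E, hE, hEc, hle⟩ := h2 E' hE' hE'c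
    exact ⟨_, entryPt_mem_entryPts s o a c G hE hEc, hle⟩
  obtain ⟨x, hx⟩ := hne
  obtain ⟨y, hy, -⟩ := hA x hx
  exact ⟨⟨y, hy⟩, vertexOf_eq_of_dom ⟨x, hx⟩ ⟨y, hy⟩ hA hB⟩

end EntryDom

section OuterShear

variable {a b c : Fin 3}

omit [DecidableEq K] in
/-- **OUTER SHEAR, DOWNWARDS (PROVED):** every monomial of the cleaned `σ_{c,a,g} G` is matched by a monomial of the cleaned `G` of the
same `b`-exponent and degree which is the same exponent or has strictly smaller `a`-exponent — a nonzero term of the shear sum;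
a `q`-th-power source would make the term vanish by Lucas or the target a `q`-th power. [new] -/
theorem exists_dom_of_mem_support_shear (hab : a ≠ b) (hac : a ≠ c) (hbc : b ≠ c)
    (hLucas : ∀ D T : ℕ, q ∣ D → ¬ q ∣ T → ((D.choose T : ℕ) : K) = 0) (g : K) (G : MvPolynomial (Fin 3) K)
    {E' : Fin 3 →₀ ℕ} (hE' : E' ∈ (deletePthPowers q (shear c a g G)).support) :
    ∃ D ∈ (deletePthPowers q G).support, D b = E' b ∧ D.degree = E'.degree ∧ (D = E' ∨ D a < E' a) := by
  classical
  rw [support_deletePthPowers', Finset.mem_filter] at hE'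
  obtain ⟨hE'S, hE'P⟩ := hE'
  have hne := mem_support_iff.mp hE'S
  rw [coeff_shear hab hac hbc g G E'] at hne
  obtain ⟨D, hD, hDne⟩ := Finset.exists_ne_zero_of_sum_ne_zero hne
  obtain ⟨n, hn, hterm⟩ := Finset.exists_ne_zero_of_sum_ne_zero hDne
  by_cases h : shearExp a b c D n = E'
  swap
  · exact absurd (if_neg h) hterm
  rw [if_pos h] at hterm
  have hn' : n ≤ D c := Nat.lt_succ_iff.mp (Finset.mem_range.mp hn)
  have hDP : ¬ IsPthPowerExponent q D := by
    intro hP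
    rw [isPthPowerExponent_iff_of_fin3 hab hac hbc D] at hP
    obtain ⟨hqa, hqb, hqc⟩ := hP
    by_cases hqn : q ∣ n
    · apply hE'P
      rw [← h, isPthPowerExponent_iff_of_fin3 hab hac hbc, shearExp_apply_fst hab hac, shearExp_apply_snd hab hbc,
        shearExp_apply_thd hac hbc]
      exact ⟨dvd_add hqa hqn, hqb, Nat.dvd_sub hqc hqn⟩
    · apply hterm
      rw [hLucas (D c) n hqc hqn, mul_zero]
  refine ⟨D, by rw [support_deletePthPowers', Finset.mem_filter]; exact ⟨hD, hDP⟩, ?_, ?_, ?_⟩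
  · rw [← h, shearExp_apply_snd hab hbc]
  · rw [← h, degree_shearExp hab hac hbc D hn']
  · rcases Nat.eq_zero_or_pos n with hn0 | hnpos
    · left; rw [← h, hn0, shearExp_zero hab hac hbc]
    · right; rw [← h, shearExp_apply_fst hab hac]; omega

omit [DecidableEq K] in
/-- **OUTER SHEAR, UPWARDS (PROVED):** every monomial of the cleaned `G` is matched by a monomial of the cleaned `σ_{c,a,g} G` of
the same `b`-exponent and degree which is the same exponent or has strictly smaller `a`-exponent — the least non-`q`-th-power
`a`-exponent on its line survives the shear (triangularity + Lucas, as in `exists_dom_swapShear`). [new] -/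
theorem exists_dom_shear_of_mem_support (hab : a ≠ b) (hac : a ≠ c) (hbc : b ≠ c)
    (hLucas : ∀ D T : ℕ, q ∣ D → ¬ q ∣ T → ((D.choose T : ℕ) : K) = 0) (g : K) (G : MvPolynomial (Fin 3) K)
    {E : Fin 3 →₀ ℕ} (hE : E ∈ (deletePthPowers q G).support) :
    ∃ E' ∈ (deletePthPowers q (shear c a g G)).support, E' b = E b ∧ E'.degree = E.degree ∧ (E' = E ∨ E' a < E a) := by
  classical
  rw [support_deletePthPowers', Finset.mem_filter] at hE
  obtain ⟨hEG, hEP⟩ := hE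
  set B := E b with hB
  set n := E a + E c with hn
  set lineExp : ℕ → (Fin 3 →₀ ℕ) := fun r => Finsupp.single a r + Finsupp.single b B + Finsupp.single c (n - r)
    with hlineExp
  have hline_a : ∀ r, lineExp r a = r := fun r => by
    simp only [hlineExp, Finsupp.add_apply, Finsupp.single_apply, ite_true, if_neg (Ne.symm hab), if_neg (Ne.symm hac),
      add_zero]
  have hline_b : ∀ r, lineExp r b = B := fun r => by
    simp only [hlineExp, Finsupp.add_apply, Finsupp.single_apply, ite_true, if_neg hab, if_neg (Ne.symm hbc), add_zero,
      zero_add]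
  have hline_c : ∀ r, lineExp r c = n - r := fun r => by
    simp only [hlineExp, Finsupp.add_apply, Finsupp.single_apply, ite_true, if_neg hac, if_neg hbc, zero_add]
  have hE_eq : lineExp (E a) = E := by
    ext w
    rcases fin3_eq_or a b c w hab hac hbc with rfl | rfl | rfl
    · rw [hline_a]
    · rw [hline_b]
    · rw [hline_c]; omega
  have hex : ∃ r, lineExp r ∈ G.support ∧ ¬ IsPthPowerExponent q (lineExp r) := ⟨E a, by rw [hE_eq]; exact ⟨hEG, hEP⟩⟩
  obtain ⟨hTG, hTP⟩ := Nat.find_spec hex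
  set T := Nat.find hex with hT
  have hTle : T ≤ E a := Nat.find_min' hex (by rw [hE_eq]; exact ⟨hEG, hEP⟩)
  have hTn : T ≤ n := le_trans hTle (by omega)
  refine ⟨lineExp T, ?_, hline_b T, ?_, ?_⟩
  · rw [support_deletePthPowers', Finset.mem_filter, mem_support_iff, coeff_shear hab hac hbc g G]
    refine ⟨?_, hTP⟩
    rw [Finset.sum_eq_single (lineExp T)]
    · rw [Finset.sum_eq_single 0]
      · rw [if_pos (shearExp_zero hab hac hbc _), pow_zero, mul_one, Nat.choose_zero_right, Nat.cast_one, mul_one]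
        exact mem_support_iff.mp hTG
      · intro m _ hm0
        rw [if_neg]
        intro h
        have h1 := congrArg (fun D : Fin 3 →₀ ℕ => D a) h
        simp only [shearExp_apply_fst hab hac] at h1
        omega
      · intro h; exact absurd (Finset.mem_range.mpr (Nat.succ_pos _)) h
    · intro D hD hne
      refine Finset.sum_eq_zero fun m hm => ?_
      split_ifs with h
      · have h1 := congrArg (fun D : Fin 3 →₀ ℕ => D a) h
        have h2 := congrArg (fun D : Fin 3 →₀ ℕ => D b) h
        have h3 := congrArg (fun D : Fin 3 →₀ ℕ => D c) h
        simp only [shearExp_apply_fst hab hac, hline_a] at h1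
        simp only [shearExp_apply_snd hab hbc, hline_b] at h2
        simp only [shearExp_apply_thd hac hbc, hline_c] at h3
        have hm' : m ≤ D c := Nat.lt_succ_iff.mp (Finset.mem_range.mp hm)
        have hDline : D = lineExp (D a) := by
          ext w
          rcases fin3_eq_or a b c w hab hac hbc with rfl | rfl | rfl
          · rw [hline_a]
          · rw [hline_b, h2]
          · rw [hline_c]; omega
        have hr : D a < T := by
          rcases (show D a ≤ T by omega).lt_or_eq with hlt | heq
          · exact hlt
          · exfalso; apply hne; rw [hDline, heq]
        have hDP : IsPthPowerExponent q D := by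
          by_contra hnp
          exact Nat.find_min hex hr ⟨by rw [← hDline]; exact hD, by rw [← hDline]; exact hnp⟩
        rw [isPthPowerExponent_iff_of_fin3 hab hac hbc] at hDP
        obtain ⟨hqa, hqb, hqc⟩ := hDP
        have hqm : ¬ q ∣ m := by
          intro hqm
          apply hTP
          rw [isPthPowerExponent_iff_of_fin3 hab hac hbc, hline_a, hline_b, hline_c]
          refine ⟨h1 ▸ dvd_add hqa hqm, h2 ▸ hqb, ?_⟩
          rw [← h3]; exact Nat.dvd_sub hqc hqm
        rw [hLucas (D c) m hqc hqm, mul_zero]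
      · rfl
    · intro h; exact absurd hTG h
  · rw [degree_fin3 hab hac hbc (lineExp T), degree_fin3 hab hac hbc E, hline_a, hline_b, hline_c]
    omega
  · rcases hTle.lt_or_eq with hlt | heq
    · right; rw [hline_a]; exact hlt
    · left; rw [heq, hE_eq]

end OuterShear

end Summit.ResolutionOfSingularities.ResolutionOfSingularities.Theorems.LossPolygon
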